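import Summits.CriticalPhenomena.PercolationContinuityZ3.Theorems.SoloBlindSlitDeepAll
import Summits.CriticalPhenomena.PercolationContinuityZ3.Theorems.SoloBlindFinRungCriterion
import Summits.CriticalPhenomena.PercolationContinuityZ3.Theorems.SoloBlindSubcritical
import Literature.Probability.Percolation.CubicCriticalProbTriangular
import HarnessLib

/-!
# Thresholds `2.8` and `8` from `p_c^bond(ℤ³) ≤ 2 sin(π/18) < 7/20`

`Summit.CriticalPhenomena.PercolationContinuityZ3.Theorems` — the chain criteria of
`SoloBlindSlitRate` (`p_c · T₀ < 1 ⟹ FinRung`) and `SoloBlindSlitDeep`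
(`M ≥ 2 ∧ p_c² · T_M < 1 ⟹ M ∈ slitPeriods ⊆ finPeriods`) combined with the proved bound
`p_c^bond(ℤ³) ≤ p_c^bond(𝕋) ≤ 2 sin(π/18) < 7/20`
(`Literature.Probability.Percolation.CubicTri.criticalProb_cubic_lt`: Gomes–Pereira–Sanchis 2026,
Theorem 1 at `d = 3`, proved in the tree from the covering map `ℤ³ → 𝕋` (Lyons–Peres Thm 6.47)
and Grimmett's `p_c(𝕋) ≤ 2 sin(π/18)`) instead of `p_c < 1/2`:

* `finRung_of_T0_le_fourteen_div_five` : **`T₀ ≤ 14/5 ⟹ FinRung`** (was `T₀ ≤ 2`); the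
  definition-free and the subcritical-uniform forms;
* `mem_slitPeriods_of_TM_le_eight`, `mem_finPeriods_of_TM_le_eight` : for `M ≥ 2`,
  **`T_M ≤ 8 ⟹ M ∈ slitPeriods ⊆ finPeriods`** (was `T_M ≤ 4`);
* `mem_finPeriods_of_T0_le_eight`, `compl_finPeriods_subset_one_of_T0_le_eight` :
  **`T₀ ≤ 8 ⟹ every period M ≥ 2`**, only the fin rung `M = 1` can fail.

Measured `T₀ ≈ 1.4` (margin ×2 for the fin rung, ×5.7 for all `M ≥ 2`), `T₂ ≈ 0.45` (×18).
-/

namespace Summit.CriticalPhenomena.PercolationContinuityZ3.Theorems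

open MeasureTheory Filter Topology Literature.Probability.Percolation Literature.Probability.LatticeModels
open scoped ENNReal

/-- `p_c(ℤ³) < 7/20` in `ℝ≥0∞` form (`CubicTri.criticalProb_cubic_lt`). -/
theorem pcE_lt_seven_div_twenty : pcE < ENNReal.ofReal (7 / 20) := by
  have h : (criticalProbI 3 : ℝ) < 7 / 20 := by
    rw [coe_criticalProbI]; exact CubicTri.criticalProb_cubic_lt
  unfold pcE
  exact (ENNReal.ofReal_lt_ofReal_iff (by norm_num)).2 h

/-- `T ≤ b ⟹ p_c · T ≤ (7/20) · b`. -/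
theorem pc_mul_le_ofReal {T : ℝ≥0∞} {b : ℝ} (hT : T ≤ ENNReal.ofReal b) :
    pcE * T ≤ ENNReal.ofReal (7 / 20 * b) := by
  calc pcE * T ≤ ENNReal.ofReal (7 / 20) * ENNReal.ofReal b :=
        mul_le_mul' pcE_lt_seven_div_twenty.le hT
    _ = ENNReal.ofReal (7 / 20 * b) := (ENNReal.ofReal_mul (by norm_num)).symm

/-- `T ≤ 14/5 ⟹ p_c · T < 1`. -/
theorem pc_mul_lt_one_of_le {T : ℝ≥0∞} (hT : T ≤ 14 / 5) : pcE * T < 1 := by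
  have hT' : T ≤ ENNReal.ofReal (14 / 5) := by
    rw [ENNReal.ofReal_div_of_pos (by norm_num : (0:ℝ) < 5)]; simpa using hT
  calc pcE * T ≤ ENNReal.ofReal (7 / 20 * (14 / 5)) := pc_mul_le_ofReal hT'
    _ < 1 := by
      rw [← ENNReal.ofReal_one]
      exact (ENNReal.ofReal_lt_ofReal_iff one_pos).2 (by norm_num)

/-- `T ≤ 8 ⟹ p_c² · T < 1`. -/
theorem pc_sq_mul_lt_one_of_le {T : ℝ≥0∞} (hT : T ≤ 8) : pcE * pcE * T < 1 := by
  have hT' : T ≤ ENNReal.ofReal 8 := by simpa using hT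
  have h1 : pcE * T ≤ ENNReal.ofReal (7 / 20 * 8) := pc_mul_le_ofReal hT'
  rw [mul_assoc]
  calc pcE * (pcE * T) ≤ ENNReal.ofReal (7 / 20 * (7 / 20 * 8)) := pc_mul_le_ofReal h1
    _ < 1 := by
      rw [← ENNReal.ofReal_one]
      exact (ENNReal.ofReal_lt_ofReal_iff one_pos).2 (by norm_num)

/-! ### The fin rung from `T₀ ≤ 2.8` -/

/-- **`T₀ ≤ 14/5 ⟹ FinRung`**: if `Σ_{w ≠ 0} P_{p_c}(0 ↔ (0,0,w) inside ℍ) ≤ 2.8` then the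
fully attached fin (bounded gaps, `M = 1`) does not percolate at `p_c(ℤ³)`. -/
theorem finRung_of_T0_le_fourteen_div_five (h : T0 ≤ 14 / 5) : SoloBlindOpenRungs.FinRung :=
  finRung_of_pc_mul_T0_lt_one (pc_mul_lt_one_of_le h)

/-- `T₀ ≤ 14/5 ⟹ slitPeriods = univ` (every slit wall, in particular the `M = 1` wall). -/
theorem slitPeriods_eq_univ_of_T0_le_fourteen_div_five (h : T0 ≤ 14 / 5) :
    slitPeriods = Set.univ :=
  slitPeriods_eq_univ_iff.2 (mem_slitPeriods_of_T0 le_rfl (pc_mul_lt_one_of_le h))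

/-- **Definition-free form.** -/
theorem finRung_of_halfSpace_lineSum_le_fourteen_div_five
    (h : ∑' w : ℤ, Set.indicator {w : ℤ | w ≠ 0}
      (fun w => bondPercolation (zdGraph 3) (criticalProbI 3)
        (openConnVia (withinGraph (zdGraph 3) {x : Site 3 | 0 ≤ x 0}) 0 (Function.update 0 2 w))) w
        ≤ 14 / 5)
    (h0 : (0 : Site 3) ∈ {x : Site 3 | 0 ≤ x 0 ∨ x 1 = 0}) :
    theta ((zdGraph 3).induce {x : Site 3 | 0 ≤ x 0 ∨ x 1 = 0}) ⟨0, h0⟩ (criticalProbI 3) = 0 :=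
  finRung_of_T0_le_fourteen_div_five (by rw [T0_eq]; exact h) h0

/-- **Subcritical-uniform form**: if `T₀(p) ≤ 14/5` for every `p < p_c(ℤ³)` (each such sum is
finite by sharpness, `T0At_lt_top`), then FinRung. -/
theorem finRung_of_forall_subcritical_le_fourteen_div_five
    (h : ∀ p : unitInterval, p < criticalProbI 3 → T0At p ≤ 14 / 5) : SoloBlindOpenRungs.FinRung :=
  finRung_of_T0_le_fourteen_div_five (T0_le_of_forall_lt h)

/-! ### Every period `M ≥ 2` from `T_M ≤ 8` (or `T₀ ≤ 8`) -/

/-- **`M ≥ 2 ∧ T_M ≤ 8 ⟹ M ∈ slitPeriods`** (isolated pores pay twice, `SoloBlindSlitDeep`). -/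
theorem mem_slitPeriods_of_TM_le_eight {M : ℕ} (hM : 2 ≤ M) (h : TM M ≤ 8) : M ∈ slitPeriods :=
  mem_slitPeriods_of_deep hM (pc_sq_mul_lt_one_of_le h)

/-- `M ≥ 2 ∧ T_M ≤ 8 ⟹ M ∈ finPeriods`. -/
theorem mem_finPeriods_of_TM_le_eight {M : ℕ} (hM : 2 ≤ M) (h : TM M ≤ 8) : M ∈ finPeriods :=
  slitPeriods_subset_finPeriods (mem_slitPeriods_of_TM_le_eight hM h)

/-- `T₀ ≤ 8 ⟹ M ∈ slitPeriods` for every `M ≥ 2` (`T_M ≤ T₀`). -/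
theorem mem_slitPeriods_of_T0_le_eight (h : T0 ≤ 8) {M : ℕ} (hM : 2 ≤ M) : M ∈ slitPeriods :=
  mem_slitPeriods_of_TM_le_eight hM ((TM_le_T0 (by omega)).trans h)

/-- **`T₀ ≤ 8 ⟹ M ∈ finPeriods` for every `M ≥ 2`.** -/
theorem mem_finPeriods_of_T0_le_eight (h : T0 ≤ 8) {M : ℕ} (hM : 2 ≤ M) : M ∈ finPeriods :=
  slitPeriods_subset_finPeriods (mem_slitPeriods_of_T0_le_eight h hM)

/-- Under `T₀ ≤ 8` the only possibly bad slit period is `1`. -/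
theorem compl_slitPeriods_subset_one_of_T0_le_eight (h : T0 ≤ 8) : slitPeriodsᶜ ⊆ {1} := by
  intro M hM
  rcases Nat.lt_or_ge M 2 with h2 | h2
  · interval_cases M
    · exact absurd zero_mem_slitPeriods hM
    · rfl
  · exact absurd (mem_slitPeriods_of_T0_le_eight h h2) hM

/-- **Under `T₀ ≤ 8` the only possibly bad fin period is `1`** (the fin rung, which needs
`T₀ ≤ 14/5`). -/
theorem compl_finPeriods_subset_one_of_T0_le_eight (h : T0 ≤ 8) : finPeriodsᶜ ⊆ {1} :=
  fun _ hM => compl_slitPeriods_subset_one_of_T0_le_eight h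
    (fun h' => hM (slitPeriods_subset_finPeriods h'))

/-- **Definition-free form, all `M ≥ 2`.** If `Σ_{w ≠ 0} P_{p_c}(0 ↔ (0,0,w) inside ℍ) ≤ 8`
then for every period `M ≥ 2` the fin region `ℍ ∪ {x₁ = 0, x₀ ≤ -2} ∪ {(-1,0,Mj)}` has
`θ(p_c(ℤ³)) = 0` at every root. -/
theorem periodicFin_theta_eq_zero_of_halfSpace_lineSum_le_eight
    (h : ∑' w : ℤ, Set.indicator {w : ℤ | w ≠ 0}
      (fun w => bondPercolation (zdGraph 3) (criticalProbI 3)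
        (openConnVia (withinGraph (zdGraph 3) {x : Site 3 | 0 ≤ x 0}) 0 (Function.update 0 2 w))) w
        ≤ 8)
    {M : ℕ} (hM : 2 ≤ M) (x : Site 3)
    (hx : x ∈ {x : Site 3 | 0 ≤ x 0} ∪
      {x : Site 3 | (x 1 = 0 ∧ x 0 ≤ -2) ∨ (x 1 = 0 ∧ x 0 = -1 ∧ (M : ℤ) ∣ x 2)}) :
    theta ((zdGraph 3).induce ({x : Site 3 | 0 ≤ x 0} ∪
      {x : Site 3 | (x 1 = 0 ∧ x 0 ≤ -2) ∨ (x 1 = 0 ∧ x 0 = -1 ∧ (M : ℤ) ∣ x 2)}))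
      ⟨x, hx⟩ (criticalProbI 3) = 0 :=
  theta_eq_zero_of_mem_finPeriods (mem_finPeriods_of_T0_le_eight (by rw [T0_eq]; exact h) hM) x hx

/-- **Summary dichotomy.** `T₀ ≤ 14/5 ⟹ finPeriods = univ`; `T₀ ≤ 8 ⟹ finPeriodsᶜ ⊆ {1}`. -/
theorem finPeriods_eq_univ_of_T0_le_fourteen_div_five (h : T0 ≤ 14 / 5) : finPeriods = Set.univ :=
  Set.eq_univ_of_univ_subset fun M _ =>
    slitPeriods_subset_finPeriods (by rw [slitPeriods_eq_univ_of_T0_le_fourteen_div_five h]; trivial)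

end Summit.CriticalPhenomena.PercolationContinuityZ3.Theorems
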